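import Mathlib
import HarnessLib
import Summits.ResolutionOfSingularities.ResolutionOfSingularities.Theses.CleanCovers
import Summits.ResolutionOfSingularities.ResolutionOfSingularities.Theorems.CleanCoversCoverResolutionSplit
import Literature.AlgebraicGeometry.Resolution.LogRegularSchemeEtale
import Literature.AlgebraicGeometry.Resolution.PrincipalizationToResolution

/-!
# Crux `CleanCovers.CoverResolution` (stmt-ResolutionOfSingularities-15104): the split is an
# EQUIVALENCE modulo Nizioł — converses of the assembly `coverResolution_of_subs`

Line `strategy-split` of the crux (line lead `prover-line-stmt-ResolutionOfSingularities-15104-0`,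
2026-08-17). The landed assembly (`Theorems/CleanCoversCoverResolutionSplit.lean`) proves
`P1 → P3 → P2 → CoverResolution` for the crux-strategist's pieces
P1 = `BoundaryLogRegularization` (base-local log-regular models along the hyperplane at infinity),
P3 = `LogRegularPatching` (patching of log-regular models over two base opens),
P2 = `LogRegularResolution` (Nizioł 2006 Cor. 5.7). This file proves the CONVERSES, so that the
ledger sees exactly how much each stub carries:

* `exists_logRegularEtaleModel_of_hasResolution`: a resolution of a locally Noetherian scheme is in
  particular a proper birational model that is log regular for fs étale charts (regular ⇒ log
  regular for the trivial log structure, Kato 1994 (2.2)(1); Zariski ⇒ étale charts).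
* `boundaryLogRegularization_of_coverResolution` (CR → P1) and
  `logRegularPatching_of_coverResolution` (CR → P3): resolve the cover by `CoverResolution`,
  restrict the resolution to the open `f⁻¹(B)` (`Scheme.HasResolution.restrict`), and read it as a
  log-regular model. Hence P1 and P3 are CONSEQUENCES of the crux (and of the summit), as the
  strategist's census asserts on paper (STRATEGY-CENSUS §1: "S ⟹ P1", "S ⟹ P3").
* `logRegularResolution_iff_niziol2006`: P2 is, up to `Iff`, the universe-`0` instance of the
  EXISTING named fact `Literature.AlgebraicGeometry.Resolution.Niziol2006_logRegularScheme_hasResolution`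
  (so the stub `stub_logRegularResolution` of the line is blocked on exactly that fact).
* `coverResolution_iff_local_and_patching`: GIVEN P2, `CoverResolution ↔ (P1 ∧ P3)` — the split
  loses nothing: modulo Nizioł's theorem the crux is equivalent to the conjunction of its two open
  children.

No `def`s; the pieces are written verbatim as binders, exactly as in the assembly file.
-/

set_option linter.dupNamespace false -- mandated namespace of this single-conjunct summit

namespace Summit.ResolutionOfSingularities.ResolutionOfSingularities.Theorems

open CategoryTheory AlgebraicGeometry TopologicalSpace
open Literature.AlgebraicGeometry.Resolution
open Summit.ResolutionOfSingularities.ResolutionOfSingularities.Theses.CleanCovers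

universe u

/-! ## A resolution is a log-regular model -/

/-- A resolution of singularities of a locally Noetherian scheme `Z` is in particular a proper
birational model of `Z` that is log regular for a finite atlas of fs étale charts: the source is
locally Noetherian (locally of finite type over `Z`) and regular, hence log regular for the trivial
log structure (Kato 1994 (2.2)(1)), hence for étale charts. [cite: Kato1994, (2.2)(1)] -/
theorem exists_logRegularEtaleModel_of_hasResolution (Z : Scheme.{u}) [IsLocallyNoetherian Z]
    (h : Scheme.HasResolution Z) :
    ∃ (Y : Scheme.{u}) (π : Y ⟶ Z), IsProper π ∧ IsBirational π ∧ Scheme.IsLogRegularEtale Y := by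
  obtain ⟨Y, π, hπ⟩ := h
  haveI := hπ.isProper
  haveI : IsLocallyNoetherian Y := LocallyOfFiniteType.isLocallyNoetherian π
  exact ⟨Y, π, inferInstance, hπ.isBirational, hπ.isRegular.isLogRegular.isLogRegularEtale⟩

/-- Over an open `B` of the base of a morphism `f : X → S` with `X` locally Noetherian: if `X` has
a resolution then `f⁻¹(B)` has a proper birational log-regular (fs étale charts) model — restrict
the resolution. [folklore] -/
theorem exists_logRegularEtaleModel_preimage_of_hasResolution {X S : Scheme.{u}}
    [IsLocallyNoetherian X] (f : X ⟶ S) (B : S.Opens) (h : Scheme.HasResolution X) :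
    ∃ (Y : Scheme.{u}) (π : Y ⟶ ((f ⁻¹ᵁ B : X.Opens) : Scheme.{u})),
      IsProper π ∧ IsBirational π ∧ Scheme.IsLogRegularEtale Y := by
  haveI : IsLocallyNoetherian ((f ⁻¹ᵁ B : X.Opens) : Scheme.{u}) :=
    isLocallyNoetherian_of_isOpenImmersion (f ⁻¹ᵁ B).ι
  exact exists_logRegularEtaleModel_of_hasResolution _ (h.restrict (f ⁻¹ᵁ B))

/-! ## The crux implies its two open children -/

/-- **`CoverResolution → BoundaryLogRegularization`** (CR ⟹ P1): resolve the Kedlaya cover, take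
`B = ⊤`, restrict. So the child P1 of the split is a consequence of the crux (hence of the summit).
[folklore] -/
theorem boundaryLogRegularization_of_coverResolution (hC : CoverResolution) :
    ∀ p : ℕ, p.Prime → ∀ (k : Type) [Field k] [CharP k p] [PerfectField k] (n : ℕ) (X : AlgebraicGeometry.Scheme.{0}) (f : X ⟶ (Literature.AlgebraicGeometry.Motives.projectiveSpace n k).left), AlgebraicGeometry.IsIntegral X → AlgebraicGeometry.IsFinite f → Function.Surjective f.base → (letI := MvPolynomial.gradedAlgebra (σ := Fin (n + 1)) (R := k); AlgebraicGeometry.Etale (f ∣_ (AlgebraicGeometry.Proj.basicOpen (MvPolynomial.homogeneousSubmodule (Fin (n + 1)) k) (MvPolynomial.X (Fin.last n))))) → ∀ h : (Literature.AlgebraicGeometry.Motives.projectiveSpace n k).left, (letI := MvPolynomial.gradedAlgebra (σ := Fin (n + 1)) (R := k); h ∉ AlgebraicGeometry.Proj.basicOpen (MvPolynomial.homogeneousSubmodule (Fin (n + 1)) k) (MvPolynomial.X (Fin.last n))) → ∃ B : (Literature.AlgebraicGeometry.Motives.projectiveSpace n k).left.Opens, h ∈ B ∧ ∃ (Y : AlgebraicGeometry.Scheme.{0})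 (π : Y ⟶ ((f ⁻¹ᵁ B : X.Opens) : AlgebraicGeometry.Scheme.{0})), AlgebraicGeometry.IsProper π ∧ Literature.AlgebraicGeometry.Resolution.IsBirational π ∧ Literature.AlgebraicGeometry.Resolution.Scheme.IsLogRegularEtale Y := by
  intro p hp k _ _ _ n X f hint hfin hsurj het h _
  have hX : Scheme.HasResolution X := hC p hp k n X f hint hfin hsurj het
  haveI := hfin
  haveI : IsProper (Literature.AlgebraicGeometry.Motives.projectiveSpace n k).hom :=
    Literature.AlgebraicGeometry.Motives.isProper_projectiveSpace n k
  haveI : IsLocallyNoetherian (Literature.AlgebraicGeometry.Motives.projectiveSpace n k).left :=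
    LocallyOfFiniteType.isLocallyNoetherian (Literature.AlgebraicGeometry.Motives.projectiveSpace n k).hom
  haveI : IsLocallyNoetherian X := LocallyOfFiniteType.isLocallyNoetherian f
  exact ⟨⊤, trivial, exists_logRegularEtaleModel_preimage_of_hasResolution f ⊤ hX⟩

/-- **`CoverResolution → LogRegularPatching`** (CR ⟹ P3): resolve the Kedlaya cover and restrict
the resolution to `f⁻¹(B₁ ⊔ B₂)`; the two hypotheses (models over `B₁`, `B₂`) are not even used.
So the child P3 of the split is a consequence of the crux (hence of the summit). [folklore] -/
theorem logRegularPatching_of_coverResolution (hC : CoverResolution) :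
    ∀ p : ℕ, p.Prime → ∀ (k : Type) [Field k] [CharP k p] [PerfectField k] (n : ℕ) (X : AlgebraicGeometry.Scheme.{0}) (f : X ⟶ (Literature.AlgebraicGeometry.Motives.projectiveSpace n k).left), AlgebraicGeometry.IsIntegral X → AlgebraicGeometry.IsFinite f → Function.Surjective f.base → (letI := MvPolynomial.gradedAlgebra (σ := Fin (n + 1)) (R := k); AlgebraicGeometry.Etale (f ∣_ (AlgebraicGeometry.Proj.basicOpen (MvPolynomial.homogeneousSubmodule (Fin (n + 1)) k) (MvPolynomial.X (Fin.last n))))) → ∀ B₁ B₂ : (Literature.AlgebraicGeometry.Motives.projectiveSpace n k).left.Opens, (∃ (Y : AlgebraicGeometry.Scheme.{0}) (π : Y ⟶ ((f ⁻¹ᵁ B₁ : X.Opens) : AlgebraicGeometry.Scheme.{0})), AlgebraicGeometry.IsProper π ∧ Literature.AlgebraicGeometry.Resolution.IsBirational π ∧ Literature.AlgebraicGeometry.Resolution.Scheme.IsLogRegularEtale Y) → (∃ (Y : AlgebraicGeometry.Scheme.{0}) (π : Y ⟶ ((f ⁻¹ᵁ B₂ : X.Opens) : AlgebraicGeometry.Scheme.{0})),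 AlgebraicGeometry.IsProper π ∧ Literature.AlgebraicGeometry.Resolution.IsBirational π ∧ Literature.AlgebraicGeometry.Resolution.Scheme.IsLogRegularEtale Y) → ∃ (Y : AlgebraicGeometry.Scheme.{0}) (π : Y ⟶ ((f ⁻¹ᵁ (B₁ ⊔ B₂) : X.Opens) : AlgebraicGeometry.Scheme.{0})), AlgebraicGeometry.IsProper π ∧ Literature.AlgebraicGeometry.Resolution.IsBirational π ∧ Literature.AlgebraicGeometry.Resolution.Scheme.IsLogRegularEtale Y := by
  intro p hp k _ _ _ n X f hint hfin hsurj het B₁ B₂ _ _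
  have hX : Scheme.HasResolution X := hC p hp k n X f hint hfin hsurj het
  haveI := hfin
  haveI : IsProper (Literature.AlgebraicGeometry.Motives.projectiveSpace n k).hom :=
    Literature.AlgebraicGeometry.Motives.isProper_projectiveSpace n k
  haveI : IsLocallyNoetherian (Literature.AlgebraicGeometry.Motives.projectiveSpace n k).left :=
    LocallyOfFiniteType.isLocallyNoetherian (Literature.AlgebraicGeometry.Motives.projectiveSpace n k).hom
  haveI : IsLocallyNoetherian X := LocallyOfFiniteType.isLocallyNoetherian f
  exact exists_logRegularEtaleModel_preimage_of_hasResolution f (B₁ ⊔ B₂) hX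

/-! ## The known child is the named fact of Nizioł 2006 -/

/-- **`LogRegularResolution ↔ Niziol2006_logRegularScheme_hasResolution.{0}`**: the third piece of
the split is, up to packaging the atlas into `Scheme.IsLogRegularEtale`, the universe-`0` instance
of the tree's named fact (Nizioł 2006, Cor. 5.7). [cite: Niziol2006, Cor. 5.7] -/
theorem logRegularResolution_iff_niziol2006 :
    (∀ (Y : AlgebraicGeometry.Scheme.{0}), CompactSpace Y → Literature.AlgebraicGeometry.Resolution.Scheme.IsLogRegularEtale Y → Literature.AlgebraicGeometry.Resolution.Scheme.HasResolution Y) ↔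
      Niziol2006_logRegularScheme_hasResolution.{0} := by
  constructor
  · intro h Y 𝒜 hc h𝒜
    exact h Y hc ⟨𝒜, h𝒜⟩
  · intro h Y hc hY
    haveI := hc
    exact h.hasResolution hY

/-! ## The split is an equivalence modulo Nizioł -/

/-- **Given `LogRegularResolution` (Nizioł 2006 Cor. 5.7), the crux `CoverResolution` is EQUIVALENT
to the conjunction of its two open children `BoundaryLogRegularization ∧ LogRegularPatching`**:
`←` is the landed assembly `coverResolution_of_subs`, `→` is restriction of a resolution of the
cover to the opens `f⁻¹(B)`. [folklore] -/
theorem coverResolution_iff_local_and_patching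
    (hP2 : ∀ (Y : AlgebraicGeometry.Scheme.{0}), CompactSpace Y → Literature.AlgebraicGeometry.Resolution.Scheme.IsLogRegularEtale Y → Literature.AlgebraicGeometry.Resolution.Scheme.HasResolution Y) :
    CoverResolution ↔
      ((∀ p : ℕ, p.Prime → ∀ (k : Type) [Field k] [CharP k p] [PerfectField k] (n : ℕ) (X : AlgebraicGeometry.Scheme.{0}) (f : X ⟶ (Literature.AlgebraicGeometry.Motives.projectiveSpace n k).left), AlgebraicGeometry.IsIntegral X → AlgebraicGeometry.IsFinite f → Function.Surjective f.base → (letI := MvPolynomial.gradedAlgebra (σ := Fin (n + 1)) (R := k); AlgebraicGeometry.Etale (f ∣_ (AlgebraicGeometry.Proj.basicOpen (MvPolynomial.homogeneousSubmodule (Fin (n + 1)) k) (MvPolynomial.X (Fin.last n))))) → ∀ h : (Literature.AlgebraicGeometry.Motives.projectiveSpace n k).left, (letI := MvPolynomial.gradedAlgebra (σ := Fin (n + 1)) (R := k); h ∉ AlgebraicGeometry.Proj.basicOpen (MvPolynomial.homogeneousSubmodule (Fin (n + 1)) k) (MvPolynomial.X (Fin.last n))) → ∃ B : (Literature.AlgebraicGeometry.Motives.projectiveSpace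 n k).left.Opens, h ∈ B ∧ ∃ (Y : AlgebraicGeometry.Scheme.{0}) (π : Y ⟶ ((f ⁻¹ᵁ B : X.Opens) : AlgebraicGeometry.Scheme.{0})), AlgebraicGeometry.IsProper π ∧ Literature.AlgebraicGeometry.Resolution.IsBirational π ∧ Literature.AlgebraicGeometry.Resolution.Scheme.IsLogRegularEtale Y) ∧
       (∀ p : ℕ, p.Prime → ∀ (k : Type) [Field k] [CharP k p] [PerfectField k] (n : ℕ) (X : AlgebraicGeometry.Scheme.{0}) (f : X ⟶ (Literature.AlgebraicGeometry.Motives.projectiveSpace n k).left), AlgebraicGeometry.IsIntegral X → AlgebraicGeometry.IsFinite f → Function.Surjective f.base → (letI := MvPolynomial.gradedAlgebra (σ := Fin (n + 1)) (R := k); AlgebraicGeometry.Etale (f ∣_ (AlgebraicGeometry.Proj.basicOpen (MvPolynomial.homogeneousSubmodule (Fin (n + 1)) k) (MvPolynomial.X (Fin.last n))))) → ∀ B₁ B₂ : (Literature.AlgebraicGeometry.Motives.projectiveSpace n k).left.Opens, (∃ (Y : AlgebraicGeometry.Scheme.{0}) (π : Y ⟶ ((f ⁻¹ᵁ B₁ :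 X.Opens) : AlgebraicGeometry.Scheme.{0})), AlgebraicGeometry.IsProper π ∧ Literature.AlgebraicGeometry.Resolution.IsBirational π ∧ Literature.AlgebraicGeometry.Resolution.Scheme.IsLogRegularEtale Y) → (∃ (Y : AlgebraicGeometry.Scheme.{0}) (π : Y ⟶ ((f ⁻¹ᵁ B₂ : X.Opens) : AlgebraicGeometry.Scheme.{0})), AlgebraicGeometry.IsProper π ∧ Literature.AlgebraicGeometry.Resolution.IsBirational π ∧ Literature.AlgebraicGeometry.Resolution.Scheme.IsLogRegularEtale Y) → ∃ (Y : AlgebraicGeometry.Scheme.{0}) (π : Y ⟶ ((f ⁻¹ᵁ (B₁ ⊔ B₂) : X.Opens) : AlgebraicGeometry.Scheme.{0})), AlgebraicGeometry.IsProper π ∧ Literature.AlgebraicGeometry.Resolution.IsBirational π ∧ Literature.AlgebraicGeometry.Resolution.Scheme.IsLogRegularEtale Y)) :=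
  ⟨fun hC => ⟨boundaryLogRegularization_of_coverResolution hC, logRegularPatching_of_coverResolution hC⟩,
    fun h => coverResolution_of_subs h.1 h.2 hP2⟩

end Summit.ResolutionOfSingularities.ResolutionOfSingularities.Theorems
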